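import Summits.BirchSwinnertonDyer.BirchSwinnertonDyer.Theorems.PrintCf2SplitBadTwoHPrimeQuarticDescent
import Summits.BirchSwinnertonDyer.BirchSwinnertonDyer.Theorems.PrintCf2SplitBadTwoAvatarValuesTwo
import Literature.NumberTheory.QuadraticFields.HeegnerCondition
import HarnessLib

/-!
# H′-bookkeeping, part 2: `K(i) ⊄ K̃_∞` and `K(√−2) ⊄ K̃_∞` for `K = ℚ(√−7)` — the characters
# `χ_{K(i)}`, `χ_{−2}` are NON-trivial on `Υ = Gal(K̄/K̃_∞)` for every generator pair (print-free)

Cell `bsd-print-cf2`, width seat `bsd-line-cf2-p1-w8` g6; crux `stmt-BirchSwinnertonDyer-20368`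
`PrintCf2.SplitBadTwoRankOneOfFacts`; -plan g20 ruling R-CLASS-4 (H′-BOOKKEEPING for LEAD g15's
`Cruxes/SplitBadTwoRankOneOfFacts/RULING-THETA-RANGE-g15.md` §2: «on `Υ`: `χ_{−1} = χ_{−2} = χ_{K(i)} ≠ 1`»,
the fact behind «no class member has `θ_d|_Υ = 1`» and «`K(E[𝔭²])·K̃_∞` is not Galois over `ℚ`»).
`--supports` the crux; Theses-free; THEOREMS ONLY (no definition, no named fact, no `sorry`).

* §1 (2-adic arithmetic, by infinite descent on the 2-adic valuation) `padicIntTwo_sq_add_mul_sq_add_sq_ne_zero`: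
  `a² + e·b² + c² ≠ 0` in `ℤ₂` for `e ∈ {1, 2}` and `c ≠ 0` (mod `8` all three are even, then divide by `4`);
  `padicTwo_sq_add_mul_sq_ne_neg_one`: `x² + e·y² ≠ −1` in `ℚ₂`.
* §2 `not_exists_sq_add_mul_sq_eq_neg_one_of_discr` — for `K` imaginary quadratic with `d_K = −7`
  (`√−7 ∈ K ↪ ℚ₂`, `QuadraticPart.ringHom_apply_mem_range_algebraMap_two`): `x² + e·y² ≠ −1` in `K`
  (`e = 1`: `−1` is not a sum of two squares in `ℚ(√−7)`; `e = 2`).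
* §3 ★ `exists_mem_pairKer_smul_eq_neg_of_discr` — `d_K = −7`, `(γ₁, γ₂)` a topological generator pair of
  `(κ₁, κ₂)` (`p = 2`), `r ∈ K̄` with `r² = −1` or `r² = −2`: **`∃ σ ∈ pairKer κ₁ κ₂, σ • r = −r`** — by part 1
  (`HPrime.exists_sq_sub_mul_sq_eq_neg_one_of_forall_mem_pairKer_smul_eq`) and §2; named instances
  `exists_mem_pairKer_smul_sqrt_neg_one_eq_neg` (`K(i) ⊄ K̃_∞`), `exists_mem_pairKer_smul_sqrt_neg_two_eq_neg`
  (`K(√−2) ⊄ K̃_∞`), and the character form `exists_mem_pairKer_quadChar_ne_one`: any `{±1}`-valued function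
  `χ` on `Γ_K` reading the action on `r` (`σ • r = χ σ • r`) takes the value `−1` on `pairKer`.

Not here (sequel, needs the rank-2/class-field-theory input «every `ℤ₂`-quotient of `Γ_K` factors through the
pair», displayed there as a hypothesis per cf2c-w2 g8 / LEAD g15): `K(√2) ⊂ K̃_∞`, `ε₁ε₂ = χ_{K(i)}`.
HONEST FRAMING: elementary; closes nothing by itself; beyond-print theorem: no.  No summit statement is
proved by this seat; BSD is not proved by any of this.

## References
* [Serre1973] J.-P. Serre, *A Course in Arithmetic* (1973), Ch. II §3.3 (squares in `ℚ₂`), Ch. III §1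
  (Hilbert symbol `(−1,−1)₂ = −1`).
* [Lang2002] S. Lang, *Algebra* (3rd ed. 2002), Ch. VI §6 (cyclic quartic extensions over `K(√a)`).
* [NeukirchANT1999] J. Neukirch, *Algebraic Number Theory* (1999), Ch. IV §1.
-/

-- the summit namespace `Summit.BirchSwinnertonDyer.BirchSwinnertonDyer` repeats the problem name by design (D-0017)
set_option linter.dupNamespace false
set_option autoImplicit false

noncomputable section

open scoped Classical

open Field NumberField Literature.NumberTheory.EllipticCurves Literature.NumberTheory.GaloisRepresentations

namespace Summit.BirchSwinnertonDyer.BirchSwinnertonDyer.Theorems.PrintCf2.HPrime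

/-! ## §1. 2-adic arithmetic: `a² + e b² + c² = 0` has no solution with `c ≠ 0` in `ℤ₂` (`e = 1, 2`) -/

/-- Mod `8`: `a² + b² + c² ≡ 0` forces `a, b, c` even. [cite: Serre1973, Ch. II §3.3] -/
theorem zmod_eight_even_of_sq_add_sq_add_sq_eq_zero :
    ∀ a b c : ZMod 8, a ^ 2 + b ^ 2 + c ^ 2 = 0 → (∃ a', a = 2 * a') ∧ (∃ b', b = 2 * b') ∧ (∃ c', c = 2 * c') := by
  decide

/-- Mod `8`: `a² + 2b² + c² ≡ 0` forces `a, b, c` even. [cite: Serre1973, Ch. II §3.3] -/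
theorem zmod_eight_even_of_sq_add_two_mul_sq_add_sq_eq_zero :
    ∀ a b c : ZMod 8, a ^ 2 + 2 * b ^ 2 + c ^ 2 = 0 → (∃ a', a = 2 * a') ∧ (∃ b', b = 2 * b') ∧ (∃ c', c = 2 * c') := by
  decide

/-- `a ≡ 2a' (mod 8)` in `ℤ₂` gives `2 ∣ a`. [folklore] -/
theorem two_dvd_of_toZModPow_three_eq_two_mul {a : ℤ_[2]} {a' : ZMod (2 ^ 3)}
    (h : PadicInt.toZModPow (p := 2) 3 a = 2 * a') : (2 : ℤ_[2]) ∣ a := by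
  obtain ⟨t, ht⟩ := ZMod.ringHom_surjective (PadicInt.toZModPow (p := 2) 3) a'
  have hk : a - 2 * t ∈ RingHom.ker (PadicInt.toZModPow (p := 2) 3) := by
    rw [RingHom.mem_ker, map_sub, map_mul, ht, h, map_ofNat, sub_self]
  rw [PadicInt.ker_toZModPow, Ideal.mem_span_singleton] at hk
  obtain ⟨m, hm⟩ := hk
  push_cast at hm
  exact ⟨t + 2 ^ 2 * m, by linear_combination hm⟩

/-- **`a² + e·b² + c² ≠ 0` in `ℤ₂` for `e ∈ {1, 2}`, `c ≠ 0`** — infinite descent: mod `8` all of `a, b, c` are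
even, and `(a/2, b/2, c/2)` is a smaller solution (induction on the valuation of `c`).  For `e = 1` this is
«`−1` is not a sum of two squares in `ℚ₂`», i.e. the Hilbert symbol `(−1,−1)₂ = −1`.
[cite: Serre1973, Ch. III §1 (Thm. 1: `(−1,−1)₂ = −1`) and Ch. II §3.3] -/
theorem padicIntTwo_sq_add_mul_sq_add_sq_ne_zero {e : ℕ} (he : e = 1 ∨ e = 2) :
    ∀ (n : ℕ) (a b c : ℤ_[2]), c ≠ 0 → c.valuation = n → a ^ 2 + e * b ^ 2 + c ^ 2 ≠ 0 := by
  intro n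
  induction n using Nat.strong_induction_on with
  | _ n ih =>
  intro a b c hc hcn h
  -- mod 8: all of `a, b, c` are even
  have h8 := congrArg (PadicInt.toZModPow (p := 2) 3) h
  simp only [map_add, map_mul, map_pow, map_natCast, map_zero] at h8
  have hev : (∃ a', PadicInt.toZModPow (p := 2) 3 a = 2 * a') ∧ (∃ b', PadicInt.toZModPow (p := 2) 3 b = 2 * b') ∧
      (∃ c', PadicInt.toZModPow (p := 2) 3 c = 2 * c') := by
    rcases he with rfl | rfl
    · exact zmod_eight_even_of_sq_add_sq_add_sq_eq_zero _ _ _ (by simpa using h8)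
    · exact zmod_eight_even_of_sq_add_two_mul_sq_add_sq_eq_zero _ _ _ (by simpa using h8)
  obtain ⟨⟨a₁, ha₁⟩, ⟨b₁, hb₁⟩, ⟨c₁, hc₁⟩⟩ := hev
  obtain ⟨a', rfl⟩ := two_dvd_of_toZModPow_three_eq_two_mul ha₁
  obtain ⟨b', rfl⟩ := two_dvd_of_toZModPow_three_eq_two_mul hb₁
  obtain ⟨c', rfl⟩ := two_dvd_of_toZModPow_three_eq_two_mul hc₁
  have hc' : c' ≠ 0 := right_ne_zero_of_mul hc
  have h2 : (2 : ℤ_[2]) ≠ 0 := two_ne_zero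
  -- the smaller solution
  have h' : a' ^ 2 + e * b' ^ 2 + c' ^ 2 = 0 := by
    have : (2 : ℤ_[2]) ^ 2 * (a' ^ 2 + e * b' ^ 2 + c' ^ 2) = 0 := by rw [← h]; ring
    exact (mul_eq_zero.mp this).resolve_left (pow_ne_zero 2 h2)
  -- the valuation drops
  have h2v : (2 : ℤ_[2]).valuation = 1 := by simpa using PadicInt.valuation_p (p := 2)
  have hval : (2 * c').valuation = c'.valuation + 1 := by
    rw [PadicInt.valuation_mul h2 hc', h2v, add_comm]
  have hlt : c'.valuation < n := by rw [← hcn, hval]; exact Nat.lt_succ_self _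
  exact ih _ hlt a' b' c' hc' rfl h'

/-- **`x² + e·y² ≠ −1` in `ℚ₂` (`e ∈ {1, 2}`)**: clear denominators by `2ⁿ` and apply
`padicIntTwo_sq_add_mul_sq_add_sq_ne_zero`. [cite: Serre1973, Ch. III §1] -/
theorem padicTwo_sq_add_mul_sq_ne_neg_one {e : ℕ} (he : e = 1 ∨ e = 2) (x y : ℚ_[2]) :
    x ^ 2 + e * y ^ 2 ≠ -1 := by
  intro h
  -- a common power of `2` making `x`, `y` integral
  obtain ⟨n, hn⟩ : ∃ n : ℕ, max ‖x‖ ‖y‖ ≤ (2 : ℝ) ^ n := by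
    obtain ⟨n, hn⟩ := pow_unbounded_of_one_lt (max ‖x‖ ‖y‖) (by norm_num : (1 : ℝ) < 2)
    exact ⟨n, hn.le⟩
  have hc : ‖((2 : ℚ_[2]) ^ n)‖ = ((2 : ℝ) ^ n)⁻¹ := by
    have h := Padic.norm_p_pow (p := 2) n
    rw [zpow_neg, zpow_natCast] at h
    exact_mod_cast h
  have hpos : (0 : ℝ) < (2 : ℝ) ^ n := by positivity
  have hX : ‖(2 : ℚ_[2]) ^ n * x‖ ≤ 1 := by
    rw [norm_mul, hc, inv_mul_le_iff₀ hpos, mul_one]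
    exact (le_max_left _ _).trans hn
  have hY : ‖(2 : ℚ_[2]) ^ n * y‖ ≤ 1 := by
    rw [norm_mul, hc, inv_mul_le_iff₀ hpos, mul_one]
    exact (le_max_right _ _).trans hn
  obtain ⟨A, hA⟩ : ∃ A : ℤ_[2], (A : ℚ_[2]) = (2 : ℚ_[2]) ^ n * x := ⟨⟨_, hX⟩, rfl⟩
  obtain ⟨B, hB⟩ : ∃ B : ℤ_[2], (B : ℚ_[2]) = (2 : ℚ_[2]) ^ n * y := ⟨⟨_, hY⟩, rfl⟩
  have hrel : A ^ 2 + e * B ^ 2 + ((2 : ℤ_[2]) ^ n) ^ 2 = 0 := by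
    have h2 : ((2 : ℤ_[2]) : ℚ_[2]) = 2 := show PadicInt.Coe.ringHom (p := 2) 2 = 2 from map_ofNat _ 2
    apply PadicInt.ext
    push_cast
    rw [hA, hB, h2]
    linear_combination ((2 : ℚ_[2]) ^ n) ^ 2 * h
  exact padicIntTwo_sq_add_mul_sq_add_sq_ne_zero he _ _ _ _ (pow_ne_zero n two_ne_zero) rfl hrel

/-! ## §2. `K = ℚ(√−7)`: `x² + e y² ≠ −1` (`√−7 ∈ ℚ₂`) -/

variable {K : Type} [Field K] [NumberField K]

/-- **For `K` imaginary quadratic with `d_K = −7`: `x² + e·y² ≠ −1` in `K` (`e ∈ {1, 2}`)** — embed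
`K = ℚ(√−7) ↪ ℚ₂` (`−7` is a 2-adic square; `QuadraticPart.ringHom_apply_mem_range_algebraMap_two`) and use
`padicTwo_sq_add_mul_sq_ne_neg_one`.  (`e = 1`: `−1` is not a sum of two squares in `ℚ(√−7)`.)
[cite: Serre1973, Ch. II §3.3, Ch. III §1] -/
theorem not_exists_sq_add_mul_sq_eq_neg_one_of_discr (hK : IsImaginaryQuadratic K) (hdK : NumberField.discr K = -7)
    {e : ℕ} (he : e = 1 ∨ e = 2) : ¬ ∃ x y : K, x ^ 2 + e * y ^ 2 = -1 := by
  rintro ⟨x, y, hxy⟩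
  -- `θ ∈ K` with `θ² = −7`
  obtain ⟨-, -, δ, -, hδ⟩ := Literature.NumberTheory.QuadraticFields.Quadratic.exists_sq_eq_discr (K := K) hK.1
  have hθ : ((δ : 𝓞 K) : K) ^ 2 = -7 := by
    have h := congrArg ((↑) : 𝓞 K → K) hδ
    push_cast at h
    rw [h, hdK]; norm_num [map_ofNat]
  -- an embedding `K → ℚ̄₂`, landing in `ℚ₂`
  let φ : K →ₐ[ℚ] PadicAlgCl 2 := IsAlgClosed.lift
  obtain ⟨x', hx'⟩ := QuadraticPart.ringHom_apply_mem_range_algebraMap_two hK.1 hθ φ.toRingHom x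
  obtain ⟨y', hy'⟩ := QuadraticPart.ringHom_apply_mem_range_algebraMap_two hK.1 hθ φ.toRingHom y
  have h := congrArg φ.toRingHom hxy
  simp only [map_add, map_mul, map_pow, map_natCast, map_neg, map_one, ← hx', ← hy'] at h
  apply padicTwo_sq_add_mul_sq_ne_neg_one he x' y'
  apply (algebraMap ℚ_[2] (PadicAlgCl 2)).injective
  simpa using h

/-! ## §3. `K(i) ⊄ K̃_∞`, `K(√−2) ⊄ K̃_∞`: the characters are non-trivial on `pairKer` -/

/-- **`d_K = −7`: a square root of `−1` or of `−2` in `K̄` is MOVED by some `σ ∈ Gal(K̄/K̃_∞) = pairKer κ₁ κ₂`**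
(for every pair of `ℤ₂`-extensions with a topological generator pair) — i.e. the quadratic characters
`χ_{K(i)}`, `χ_{−2}` of `Γ_K` are non-trivial on `Υ`; `K(i) ⊄ K̃_∞`, `K(√−2) ⊄ K̃_∞`.  Part 1's cyclic-quartic
obstruction + §2.  [cite: Lang2002, Ch. VI §6] [cite: Serre1973, Ch. III §1] -/
theorem exists_mem_pairKer_smul_eq_neg_of_discr (hK : IsImaginaryQuadratic K) (hdK : NumberField.discr K = -7)
    {κ₁ κ₂ : ZpExtension K 2} {γ₁ γ₂ : absoluteGaloisGroup K} (hγ : ZpExtension.IsTopGeneratorPair κ₁ κ₂ γ₁ γ₂)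
    {e : ℕ} (he : e = 1 ∨ e = 2) {r : AlgebraicClosure K}
    (hr : r ^ 2 = -(e : AlgebraicClosure K)) : ∃ σ ∈ ZpExtension.pairKer κ₁ κ₂, σ • r = -r := by
  by_contra hcon
  push Not at hcon
  have hr' : r ^ 2 = algebraMap K (AlgebraicClosure K) (-(e : K)) := by rw [hr, map_neg, map_natCast]
  have he0 : (-(e : K)) ≠ 0 := by rcases he with rfl | rfl <;> norm_num
  -- every `σ ∈ pairKer` fixes `r` (it acts by `±1` and `−r` is excluded)
  have hfix : ∀ σ ∈ ZpExtension.pairKer κ₁ κ₂, σ • r = r := by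
    intro σ hσ
    have hsq : (σ • r) ^ 2 = r ^ 2 := by rw [← smul_pow', hr', smul_algebraMap_eq]
    rcases sq_eq_sq_iff_eq_or_eq_neg.mp hsq with h | h
    · exact h
    · exact (hcon σ hσ h).elim
  obtain ⟨x, y, hxy⟩ := exists_sq_sub_mul_sq_eq_neg_one_of_forall_mem_pairKer_smul_eq hγ he0 hr' hfix
  exact not_exists_sq_add_mul_sq_eq_neg_one_of_discr hK hdK he ⟨x, y, by linear_combination hxy⟩

/-- **`K(i) ⊄ K̃_∞` for `K = ℚ(√−7)`**: some `σ ∈ pairKer κ₁ κ₂` sends `i ↦ −i` (`i² = −1`), for every generator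
pair; equivalently `χ_{K(i)}|_Υ ≠ 1` (LEAD g15 RULING-THETA-RANGE §2: `χ_{−1} = χ_{K(i)} = ε₁ε₂ ≠ 1` on `Υ`).
[cite: Lang2002, Ch. VI §6] [cite: Serre1973, Ch. III §1] -/
theorem exists_mem_pairKer_smul_sqrt_neg_one_eq_neg (hK : IsImaginaryQuadratic K) (hdK : NumberField.discr K = -7)
    {κ₁ κ₂ : ZpExtension K 2} {γ₁ γ₂ : absoluteGaloisGroup K} (hγ : ZpExtension.IsTopGeneratorPair κ₁ κ₂ γ₁ γ₂)
    {i : AlgebraicClosure K} (hi : i ^ 2 = -1) : ∃ σ ∈ ZpExtension.pairKer κ₁ κ₂, σ • i = -i :=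
  exists_mem_pairKer_smul_eq_neg_of_discr hK hdK hγ (e := 1) (Or.inl rfl) (by rw [hi]; norm_num)

/-- **`K(√−2) ⊄ K̃_∞` for `K = ℚ(√−7)`**: some `σ ∈ pairKer κ₁ κ₂` sends `√−2 ↦ −√−2`, for every generator
pair (`χ_{−2}|_Υ ≠ 1`). [cite: Lang2002, Ch. VI §6] [cite: Serre1973, Ch. III §1] -/
theorem exists_mem_pairKer_smul_sqrt_neg_two_eq_neg (hK : IsImaginaryQuadratic K) (hdK : NumberField.discr K = -7)
    {κ₁ κ₂ : ZpExtension K 2} {γ₁ γ₂ : absoluteGaloisGroup K} (hγ : ZpExtension.IsTopGeneratorPair κ₁ κ₂ γ₁ γ₂)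
    {r : AlgebraicClosure K} (hr : r ^ 2 = -2) : ∃ σ ∈ ZpExtension.pairKer κ₁ κ₂, σ • r = -r :=
  exists_mem_pairKer_smul_eq_neg_of_discr hK hdK hγ (e := 2) (Or.inr rfl) (by rw [hr]; norm_num)

/-- **Character form.**  `d_K = −7`, `r² ∈ {−1, −2}`; any `χ : Γ_K → ℤˣ` reading the Galois action on `r`
(`σ • r = χ σ • r`, e.g. the quadratic character of `K(r)/K`) takes the value `−1` somewhere on
`pairKer κ₁ κ₂ = Gal(K̄/K̃_∞)`: the character does NOT factor through the `ℤ₂²`-tower.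
[cite: Lang2002, Ch. VI §6] [cite: Serre1973, Ch. III §1] -/
theorem exists_mem_pairKer_quadChar_eq_neg_one (hK : IsImaginaryQuadratic K) (hdK : NumberField.discr K = -7)
    {κ₁ κ₂ : ZpExtension K 2} {γ₁ γ₂ : absoluteGaloisGroup K} (hγ : ZpExtension.IsTopGeneratorPair κ₁ κ₂ γ₁ γ₂)
    {e : ℕ} (he : e = 1 ∨ e = 2) {r : AlgebraicClosure K} (hr : r ^ 2 = -(e : AlgebraicClosure K))
    (χ : absoluteGaloisGroup K → ℤˣ) (hχ : ∀ σ, σ • r = ((χ σ : ℤˣ) : ℤ) • r) :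
    ∃ σ ∈ ZpExtension.pairKer κ₁ κ₂, χ σ = -1 := by
  obtain ⟨σ, hσ, hσr⟩ := exists_mem_pairKer_smul_eq_neg_of_discr hK hdK hγ he hr
  refine ⟨σ, hσ, ?_⟩
  have hr0 : r ≠ 0 := by
    rintro rfl
    rcases he with rfl | rfl <;> norm_num at hr
  rcases Int.units_eq_one_or (χ σ) with h | h
  · exfalso
    rw [hχ σ, h, Units.val_one, one_smul] at hσr
    have : (2 : AlgebraicClosure K) * r = 0 := by linear_combination hσr
    simp [hr0] at this
  · exact h

end Summit.BirchSwinnertonDyer.BirchSwinnertonDyer.Theorems.PrintCf2.HPrime
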